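import Mathlib
import Literature.MathematicalPhysics.QuantumLattice.LatticeScalarField

/-!
# Route `UniversalDetector`, LINE «blind detector» (item stmt-QuantumFields-24148 `BlindDetector`, stub
# `BlindSeqExtraction`): inside one orthant, AXIS moduli add up to a full (linear) modulus

Fleet lead `ym-spine-19353-p1` g26 (crux `BalabanLadder.NT`, LINE g11-1 of ym-idea-8).  Pure lattice bookkeeping for
the blind extraction: the stub's hypothesis `hLong` (the conclusion of the PROVED `HankelLongitudinal`) controls a
rescaled lattice kernel `g` only ALONG COORDINATE AXES, on box segments that stay off the `η`-ball and keep the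
moving coordinate outside the slab `|s z_k| < τ`.  On the «orthant regions»
`Ω_η(s) = {z ∈ box L | η ≤ |s z_i| for all i}` this is enough:

* `segment_conditions` — a box segment in direction `k` whose endpoints have their `k`-th coordinates of the same
  sign and of size `≥ η/s` satisfies the three side conditions of `hLong` (with `τ = η`) at every point;
* `abs_sub_update_le` — changing ONE coordinate inside `Ω_η(s)` without changing its sign costs
  `≤ Λ · s · |Δ|`;
* `abs_sub_le_of_sameOrthant` — two points of `Ω_η(s)` in the SAME orthant: `|g z − g z'| ≤ Λ s Σᵢ |zᵢ − z'ᵢ|`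
  (four coordinate updates), hence `≤ 4Λ ‖s z − s z'‖`;
* `two_eta_le_norm_of_oppositeSign` — two points of `Ω_η(s)` in DIFFERENT orthants are `≥ 2η` apart;
* **`abs_sub_le_linearModulus`** — with a bound `|g| ≤ C` on `Ω_η(s)`: for all `z, z' ∈ Ω_η(s)`,
  `|g z − g z'| ≤ (4Λ + C/η) · ‖s z − s z'‖` — the `hM`-shaped hypothesis of `meshArzelaAscoliOn` for the gauge
  `ρ z = minᵢ |zᵢ|`.

No lattice gauge theory enters (abstract `g : Site 4 → ℝ`); no summit, rung or crux statement is proved here.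
[folklore]
-/

set_option autoImplicit false

namespace Summit.QuantumFields.YangMills.Cruxes.UniversalDetectorBlindExtraction

open Finset
open Literature.MathematicalPhysics.QuantumLattice (siteToE siteToE_apply)
open Literature.Probability.LatticeModels (Site box mem_box)

/-! ### Coordinates versus the norm in physical units -/

/-- `|s zᵢ| ≤ ‖s z‖`. [folklore] -/
theorem abs_smul_coord_le_norm (s : ℝ) (z : Site 4) (i : Fin 4) :
    |s * (z i : ℝ)| ≤ ‖s • siteToE z‖ := by
  have h : ‖(s • siteToE z) i‖ ≤ ‖s • siteToE z‖ := PiLp.norm_apply_le (s • siteToE z) i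
  simpa [Real.norm_eq_abs, siteToE_apply] using h

/-- `|s (zᵢ − z'ᵢ)| ≤ ‖s z − s z'‖`. [folklore] -/
theorem abs_smul_coord_sub_le_norm (s : ℝ) (z z' : Site 4) (i : Fin 4) :
    |s * ((z i : ℝ) - z' i)| ≤ ‖s • siteToE z - s • siteToE z'‖ := by
  have h : ‖(s • siteToE z - s • siteToE z') i‖ ≤ ‖s • siteToE z - s • siteToE z'‖ :=
    PiLp.norm_apply_le (s • siteToE z - s • siteToE z') i
  simpa [Real.norm_eq_abs, siteToE_apply, mul_sub] using h

/-- `Σᵢ |s (zᵢ − z'ᵢ)| ≤ 4 ‖s z − s z'‖`. [folklore] -/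
theorem sum_abs_smul_coord_sub_le (s : ℝ) (z z' : Site 4) :
    ∑ i : Fin 4, |s * ((z i : ℝ) - z' i)| ≤ 4 * ‖s • siteToE z - s • siteToE z'‖ := by
  calc ∑ i : Fin 4, |s * ((z i : ℝ) - z' i)| ≤ ∑ _i : Fin 4, ‖s • siteToE z - s • siteToE z'‖ :=
        sum_le_sum fun i _ => abs_smul_coord_sub_le_norm s z z' i
    _ = 4 * ‖s • siteToE z - s • siteToE z'‖ := by simp

/-! ### Box segments inside one orthant region -/

/-- Coordinates of a point moved along the axis `k`. [folklore] -/
theorem add_single_apply (b : Site 4) (k : Fin 4) (j : ℤ) (i : Fin 4) :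
    (b + Pi.single k j : Site 4) i = if i = k then b k + j else b i := by
  by_cases hi : i = k
  · subst hi; simp
  · simp [hi]

/-- **The moving coordinate stays outside the slab.**  If `b_k` and `b_k + n` have the same sign and both
`η ≤ |s b_k|`, `η ≤ |s (b_k + n)|` (`s, η > 0`), then `η ≤ |s (b_k + j)|` for all `0 ≤ j ≤ n`. [folklore] -/
theorem eta_le_abs_of_between {s η : ℝ} (hs : 0 < s) {c : ℤ} {n j : ℕ} (hj : j ≤ n)
    (hlo : η ≤ |s * (c : ℝ)|) (hhi : η ≤ |s * ((c : ℝ) + n)|) (hsign : 0 < c * (c + n)) :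
    η ≤ |s * ((c : ℝ) + j)| := by
  have hjn : (j : ℝ) ≤ n := by exact_mod_cast hj
  have hj0 : (0 : ℝ) ≤ j := Nat.cast_nonneg j
  rcases lt_trichotomy c 0 with hc | hc | hc
  · -- `c < 0`: then `c + n < 0`, the segment is negative
    have hcn : c + (n : ℤ) < 0 := by
      by_contra h
      push Not at h
      have : c * (c + n) ≤ 0 := mul_nonpos_of_nonpos_of_nonneg hc.le h
      linarith
    have hcnR : (c : ℝ) + n < 0 := by exact_mod_cast hcn
    have h1 : s * ((c : ℝ) + j) ≤ s * ((c : ℝ) + n) := by nlinarith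
    have h2 : s * ((c : ℝ) + n) < 0 := mul_neg_of_pos_of_neg hs hcnR
    rw [abs_of_neg h2] at hhi
    rw [abs_of_neg (lt_of_le_of_lt h1 h2)]
    linarith
  · exfalso
    subst hc
    simp at hsign
  · have hcR : (0 : ℝ) < c := by exact_mod_cast hc
    have h1 : s * (c : ℝ) ≤ s * ((c : ℝ) + j) := by nlinarith
    have h2 : 0 < s * (c : ℝ) := mul_pos hs hcR
    rw [abs_of_pos h2] at hlo
    rw [abs_of_pos (lt_of_lt_of_le h2 h1)]
    linarith

/-- **A box segment inside one orthant region meets the three side conditions of `hLong` (with `τ = η`).**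
Base point `b`, direction `k`, length `n`: the other coordinates are box coordinates with `η ≤ |s bᵢ|`; the moving
coordinate runs from `b_k` to `b_k + n` inside `[-L, L]`, both ends of size `≥ η/s` and of the same sign.
[folklore] -/
theorem segment_conditions {L : ℕ} {s η : ℝ} (hs : 0 < s) (b : Site 4) (k : Fin 4) (n : ℕ)
    (hbox : ∀ i, i ≠ k → -(L : ℤ) ≤ b i ∧ b i ≤ L) (hηo : ∀ i, i ≠ k → η ≤ |s * (b i : ℝ)|)
    (hlo : -(L : ℤ) ≤ b k) (hhi : b k + n ≤ (L : ℤ)) (hηlo : η ≤ |s * (b k : ℝ)|)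
    (hηhi : η ≤ |s * ((b k : ℝ) + n)|) (hsign : 0 < b k * (b k + n)) :
    ∀ j : ℕ, j ≤ n →
      (b + Pi.single k (j : ℤ) ∈ box 4 L ∧ η ≤ ‖s • siteToE (b + Pi.single k (j : ℤ))‖ ∧
        η ≤ |s * ((b k : ℝ) + j)|) ∧
      (∀ i : Fin 4, η ≤ |s * (((b + Pi.single k (j : ℤ) : Site 4) i : ℤ) : ℝ)|) := by
  intro j hj
  have hmove : η ≤ |s * ((b k : ℝ) + j)| := eta_le_abs_of_between hs hj hηlo hηhi hsign
  have hcoord : ∀ i : Fin 4, η ≤ |s * (((b + Pi.single k (j : ℤ) : Site 4) i : ℤ) : ℝ)| := by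
    intro i
    rw [add_single_apply]
    by_cases hi : i = k
    · rw [if_pos hi]; push_cast; exact hmove
    · rw [if_neg hi]; exact hηo i hi
  refine ⟨⟨?_, ?_, hmove⟩, hcoord⟩
  · rw [mem_box]
    intro i
    rw [add_single_apply]
    by_cases hi : i = k
    · rw [if_pos hi]
      have hjn : (j : ℤ) ≤ n := by exact_mod_cast hj
      constructor <;> omega
    · rw [if_neg hi]; exact hbox i hi
  · exact (hcoord 0).trans (abs_smul_coord_le_norm s _ 0)

/-! ### One coordinate update inside an orthant region -/

/-- **Changing one coordinate without changing its sign** costs at most `Λ · s · |Δ|` for a kernel with the axis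
modulus `hAx` (the shape of `hLong` at one lattice, with `τ = η`), and stays in the orthant region. [folklore] -/
theorem abs_sub_update_le {L : ℕ} {s η Λ : ℝ} (hs : 0 < s) (g : Site 4 → ℝ)
    (hAx : ∀ (k : Fin 4) (z : Site 4) (n : ℕ),
      (∀ j : ℕ, j ≤ n → z + Pi.single k (j : ℤ) ∈ box 4 L ∧ η ≤ ‖s • siteToE (z + Pi.single k (j : ℤ))‖ ∧
        η ≤ |s * ((z k : ℝ) + j)|) → |g z - g (z + Pi.single k (n : ℤ))| ≤ Λ * (s * n))
    (w : Site 4) (hw : w ∈ box 4 L) (hwη : ∀ i, η ≤ |s * (w i : ℝ)|) (k : Fin 4) (t : ℤ)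
    (ht : -(L : ℤ) ≤ t ∧ t ≤ L) (htη : η ≤ |s * (t : ℝ)|) (hsign : 0 < w k * t) :
    |g w - g (Function.update w k t)| ≤ Λ * (s * |(t : ℝ) - w k|) ∧
      Function.update w k t ∈ box 4 L ∧ ∀ i, η ≤ |s * ((Function.update w k t i : ℤ) : ℝ)| := by
  rw [mem_box] at hw
  have hupd : ∀ (b : Site 4) (m : ℤ), b k + m = t → (∀ i, i ≠ k → b i = w i) →
      b + Pi.single k m = Function.update w k t := by
    intro b m hm hb
    funext i
    rw [add_single_apply, Function.update_apply]
    by_cases hi : i = k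
    · rw [if_pos hi, if_pos hi, hm]
    · rw [if_neg hi, if_neg hi, hb i hi]
  rcases le_or_gt (w k) t with hle | hlt
  · -- move up from `w` to `update w k t`
    set n : ℕ := (t - w k).toNat with hn
    have hnZ : (n : ℤ) = t - w k := Int.toNat_of_nonneg (by omega)
    have hnR : (n : ℝ) = (t : ℝ) - w k := by exact_mod_cast hnZ
    have heq : w + Pi.single k (n : ℤ) = Function.update w k t := hupd w n (by omega) (fun i _ => rfl)
    have hseg := segment_conditions hs w k n (fun i _ => hw i) (fun i _ => hwη i) (hw k).1
      (by have := (hw k).2; omega) (hwη k)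
      (by rw [hnR]; simpa using htη) (by rw [hnZ]; simpa using hsign)
    have h1 := hAx k w n fun j hj => (hseg j hj).1
    rw [heq, hnR] at h1
    refine ⟨?_, ?_, ?_⟩
    · have habs : |(t : ℝ) - w k| = (t : ℝ) - w k := abs_of_nonneg (by rw [← hnR]; exact Nat.cast_nonneg n)
      rw [habs]; exact h1
    · have := (hseg n le_rfl).1.1; rwa [heq] at this
    · have := (hseg n le_rfl).2; rwa [heq] at this
  · -- move up from `update w k t` to `w`
    set b : Site 4 := Function.update w k t with hb
    set n : ℕ := (w k - t).toNat with hn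
    have hnZ : (n : ℤ) = w k - t := Int.toNat_of_nonneg (by omega)
    have hnR : (n : ℝ) = (w k : ℝ) - t := by exact_mod_cast hnZ
    have hbk : b k = t := by simp [hb]
    have hbi : ∀ i, i ≠ k → b i = w i := fun i hi => by simp [hb, hi]
    have heq : b + Pi.single k (n : ℤ) = w := by
      funext i
      rw [add_single_apply]
      by_cases hi : i = k
      · rw [if_pos hi, hbk, hnZ, hi]; ring
      · rw [if_neg hi, hbi i hi]
    have hseg := segment_conditions hs b k n (fun i hi => by rw [hbi i hi]; exact hw i)
      (fun i hi => by rw [hbi i hi]; exact hwη i) (by rw [hbk]; exact ht.1)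
      (by rw [hbk]; have := (hw k).2; omega)
      (by rw [hbk]; exact htη) (by rw [hbk, hnR]; simpa using hwη k)
      (by rw [hbk, hnZ]; have : t * (t + (w k - t)) = w k * t := by ring
          rw [this]; exact hsign)
    have h1 := hAx k b n fun j hj => (hseg j hj).1
    rw [heq, hnR, abs_sub_comm] at h1
    refine ⟨?_, ?_, ?_⟩
    · have habs : |(t : ℝ) - w k| = (w k : ℝ) - t := by
        rw [abs_sub_comm, abs_of_nonneg]
        have : (t : ℝ) < w k := by exact_mod_cast hlt
        linarith
      rwa [habs]
    · have := (hseg 0 (Nat.zero_le n)).1.1; simpa using this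
    · have := (hseg 0 (Nat.zero_le n)).2; simpa using this

/-! ### Two points of the same orthant region -/

/-- **Same orthant: the axis moduli add up** — four coordinate updates from `z` to `z'`. [folklore] -/
theorem abs_sub_le_of_sameOrthant {L : ℕ} {s η Λ : ℝ} (hs : 0 < s) (g : Site 4 → ℝ)
    (hAx : ∀ (k : Fin 4) (z : Site 4) (n : ℕ),
      (∀ j : ℕ, j ≤ n → z + Pi.single k (j : ℤ) ∈ box 4 L ∧ η ≤ ‖s • siteToE (z + Pi.single k (j : ℤ))‖ ∧
        η ≤ |s * ((z k : ℝ) + j)|) → |g z - g (z + Pi.single k (n : ℤ))| ≤ Λ * (s * n))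
    (z z' : Site 4) (hz : z ∈ box 4 L) (hz' : z' ∈ box 4 L) (hzη : ∀ i, η ≤ |s * (z i : ℝ)|)
    (hz'η : ∀ i, η ≤ |s * (z' i : ℝ)|) (hsign : ∀ i, 0 < z i * z' i) :
    |g z - g z'| ≤ Λ * ∑ i : Fin 4, |s * ((z i : ℝ) - z' i)| := by
  have hz'box := mem_box.1 hz'
  -- the chain of updates
  set w1 : Site 4 := Function.update z 0 (z' 0) with hw1
  obtain ⟨d1, hw1b, hw1η⟩ := abs_sub_update_le hs g hAx z hz hzη 0 (z' 0) (hz'box 0) (hz'η 0) (hsign 0)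
  have hw11 : w1 1 = z 1 := by simp [hw1]
  set w2 : Site 4 := Function.update w1 1 (z' 1) with hw2
  obtain ⟨d2, hw2b, hw2η⟩ := abs_sub_update_le hs g hAx w1 hw1b hw1η 1 (z' 1) (hz'box 1) (hz'η 1)
    (by rw [hw11]; exact hsign 1)
  have hw22 : w2 2 = z 2 := by simp [hw2, hw1]
  set w3 : Site 4 := Function.update w2 2 (z' 2) with hw3
  obtain ⟨d3, hw3b, hw3η⟩ := abs_sub_update_le hs g hAx w2 hw2b hw2η 2 (z' 2) (hz'box 2) (hz'η 2)
    (by rw [hw22]; exact hsign 2)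
  have hw33 : w3 3 = z 3 := by simp [hw3, hw2, hw1]
  obtain ⟨d4, -, -⟩ := abs_sub_update_le hs g hAx w3 hw3b hw3η 3 (z' 3) (hz'box 3) (hz'η 3)
    (by rw [hw33]; exact hsign 3)
  have hw4 : Function.update w3 3 (z' 3) = z' := by
    funext i
    fin_cases i <;> simp [hw3, hw2, hw1]
  rw [hw4] at d4
  rw [hw11] at d2
  rw [hw22] at d3
  rw [hw33] at d4
  have hΛ : 0 ≤ Λ ∨ Λ < 0 := le_or_gt 0 Λ
  -- triangle inequality along the chain
  have htri : |g z - g z'| ≤ |g z - g w1| + |g w1 - g w2| + |g w2 - g w3| + |g w3 - g z'| := by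
    have e : g z - g z' = (g z - g w1) + (g w1 - g w2) + (g w2 - g w3) + (g w3 - g z') := by ring
    rw [e]
    refine (abs_add_le _ _).trans (add_le_add ((abs_add_le _ _).trans (add_le_add ((abs_add_le _ _).trans
      (add_le_add le_rfl le_rfl)) le_rfl)) le_rfl)
  have hsum : ∑ i : Fin 4, |s * ((z i : ℝ) - z' i)| =
      s * |(z' 0 : ℝ) - z 0| + s * |(z' 1 : ℝ) - z 1| + s * |(z' 2 : ℝ) - z 2| + s * |(z' 3 : ℝ) - z 3| := by
    rw [Fin.sum_univ_four]
    simp only [abs_mul, abs_of_pos hs, abs_sub_comm]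
  rw [hsum]
  nlinarith [d1, d2, d3, d4, htri]

/-- **Different orthants are `2η` apart**: if some coordinate changes sign between two points of the orthant
region, their physical distance is at least `2η`. [folklore] -/
theorem two_eta_le_norm_of_oppositeSign {s η : ℝ} (z z' : Site 4) (i : Fin 4)
    (hzη : η ≤ |s * (z i : ℝ)|) (hz'η : η ≤ |s * (z' i : ℝ)|) (hsign : z i * z' i < 0) :
    2 * η ≤ ‖s • siteToE z - s • siteToE z'‖ := by
  refine le_trans ?_ (abs_smul_coord_sub_le_norm s z z' i)
  rw [mul_sub]
  -- opposite signs: `|x| + |y| ≤ |x - y|`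
  have key : ∀ x y : ℝ, x * y ≤ 0 → |x| + |y| ≤ |x - y| := by
    intro x y hxy
    rcases le_total 0 x with hx | hx
    · rcases le_total 0 y with hy | hy
      · have h0 : x * y = 0 := le_antisymm hxy (mul_nonneg hx hy)
        rcases mul_eq_zero.1 h0 with h | h
        · rw [h]; simp
        · rw [h]; simp
      · rw [abs_of_nonneg hx, abs_of_nonpos hy, abs_of_nonneg (by linarith)]; linarith
    · rcases le_total 0 y with hy | hy
      · rw [abs_of_nonpos hx, abs_of_nonneg hy, abs_of_nonpos (by linarith)]; linarith
      · have h0 : x * y = 0 := le_antisymm hxy (by nlinarith)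
        rcases mul_eq_zero.1 h0 with h | h
        · rw [h]; simp
        · rw [h]; simp
  have hprod : (s * (z i : ℝ)) * (s * (z' i : ℝ)) ≤ 0 := by
    have h1 : ((z i : ℤ) : ℝ) * (z' i : ℝ) < 0 := by exact_mod_cast hsign
    nlinarith [sq_nonneg s]
  have h := key _ _ hprod
  linarith

/-- **The linear modulus on an orthant region.**  If `|g| ≤ C` on `Ω_η(s) = {z ∈ box L | η ≤ |s zᵢ| ∀ i}` and `g`
has the axis modulus `hAx` (slope `Λ ≥ 0`), then for all `z, z' ∈ Ω_η(s)`: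
`|g z − g z'| ≤ (4Λ + C/η) ‖s z − s z'‖`. [folklore] -/
theorem abs_sub_le_linearModulus {L : ℕ} {s η Λ C : ℝ} (hs : 0 < s) (hη : 0 < η) (hΛ : 0 ≤ Λ) (hC : 0 ≤ C)
    (g : Site 4 → ℝ)
    (hAx : ∀ (k : Fin 4) (z : Site 4) (n : ℕ),
      (∀ j : ℕ, j ≤ n → z + Pi.single k (j : ℤ) ∈ box 4 L ∧ η ≤ ‖s • siteToE (z + Pi.single k (j : ℤ))‖ ∧
        η ≤ |s * ((z k : ℝ) + j)|) → |g z - g (z + Pi.single k (n : ℤ))| ≤ Λ * (s * n))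
    (hB : ∀ z ∈ box 4 L, (∀ i, η ≤ |s * (z i : ℝ)|) → |g z| ≤ C)
    (z z' : Site 4) (hz : z ∈ box 4 L) (hz' : z' ∈ box 4 L) (hzη : ∀ i, η ≤ |s * (z i : ℝ)|)
    (hz'η : ∀ i, η ≤ |s * (z' i : ℝ)|) :
    |g z - g z'| ≤ (4 * Λ + C / η) * ‖s • siteToE z - s • siteToE z'‖ := by
  have hnorm0 : 0 ≤ ‖s • siteToE z - s • siteToE z'‖ := norm_nonneg _
  by_cases hsame : ∀ i, 0 < z i * z' i
  · have h1 := abs_sub_le_of_sameOrthant hs g hAx z z' hz hz' hzη hz'η hsame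
    have h2 := sum_abs_smul_coord_sub_le s z z'
    calc |g z - g z'| ≤ Λ * ∑ i : Fin 4, |s * ((z i : ℝ) - z' i)| := h1
      _ ≤ Λ * (4 * ‖s • siteToE z - s • siteToE z'‖) := mul_le_mul_of_nonneg_left h2 hΛ
      _ = 4 * Λ * ‖s • siteToE z - s • siteToE z'‖ := by ring
      _ ≤ (4 * Λ + C / η) * ‖s • siteToE z - s • siteToE z'‖ := by
          have : 0 ≤ C / η * ‖s • siteToE z - s • siteToE z'‖ := by positivity
          nlinarith
  · push Not at hsame
    obtain ⟨i, hi⟩ := hsame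
    have hne : z i * z' i ≠ 0 := by
      intro h0
      rcases mul_eq_zero.1 h0 with h | h
      · have := hzη i; rw [h] at this; simp at this; linarith
      · have := hz'η i; rw [h] at this; simp at this; linarith
    have hneg : z i * z' i < 0 := lt_of_le_of_ne hi hne
    have hfar := two_eta_le_norm_of_oppositeSign z z' i (hzη i) (hz'η i) hneg
    have hgz := hB z hz hzη
    have hgz' := hB z' hz' hz'η
    calc |g z - g z'| ≤ |g z| + |g z'| := abs_sub _ _
      _ ≤ C + C := add_le_add hgz hgz'
      _ = C / η * (2 * η) := by field_simp; ring
      _ ≤ C / η * ‖s • siteToE z - s • siteToE z'‖ := mul_le_mul_of_nonneg_left hfar (by positivity)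
      _ ≤ (4 * Λ + C / η) * ‖s • siteToE z - s • siteToE z'‖ := by nlinarith

end Summit.QuantumFields.YangMills.Cruxes.UniversalDetectorBlindExtraction
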